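import Literature.Topology.FourManifolds.ComplexProjectiveSpaceCohomology
import Literature.Topology.FourManifolds.HomotopySpheresStablyParallelizableHomotopyGroup
import Literature.AlgebraicTopology.Homotopy.HopfFibration
import Literature.AlgebraicTopology.Homotopy.SuspensionMaps
import Literature.AlgebraicTopology.Homotopy.SuspensionSphere
import HarnessLib

/-!
# The suspension of `ℂℙ²`: `S(ℂℙ²) = S(ℂℙ¹) ∪ e⁵` and the retraction criterion

Topic `Literature/Topology/FourManifolds` (home of the tree's `ComplexProjectiveSpace`). A. Hatcher,
*Algebraic Topology* (2002), Example 0.6 (`ℂPⁿ = ℂPⁿ⁻¹ ∪ e²ⁿ`, the `2n`-cell attached by the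
characteristic map `(w) ↦ [w : √(1 - |w|²)]` whose restriction to the boundary sphere is the
quotient `S²ⁿ⁻¹ → ℂPⁿ⁻¹`), Ch. 0 p. 8 (suspension), §4.1 p. 346 (a null-homotopic map of a sphere
extends over the ball) and Example 4.45 / §4.2 (the attaching map of the `4`-cell of `ℂP²` is the
Hopf map). This is the geometric half of the classical proof that the suspension of the Hopf map is
essential (`π₄(S³) ≠ 0`), via the Steenrod square `Sq²` on `S(ℂℙ²)` (not in this file). PROVED:

* `charMap : C(D⁴, ℂℙ²)`, `(z, w) ↦ [z : w : √(1 - |z|² - |w|²)]` — onto (`charMap_surjective`),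
  one-to-one off the boundary (`eq_of_charMap_eq`), and `[z : w : 0]` on the boundary
  (`charMap_sphIncl`: `Φ ∘ (S³ ⊂ D⁴) = (ℂℙ¹ ⊂ ℂℙ²) ∘ (S³ → ℂℙ¹)`), `hopfC : C(S³, ℂℙ¹)` onto;
* the suspended picture: `belt = S(S³) ⊂ S(D⁴)` (`≅ S⁴`, `beltSphere`), `subLine = S(ℂℙ¹) ⊂
  S(ℂℙ²)` (`≅ S³`, `subLineSphere`), `image_belt` (`SΦ(belt) = S(ℂℙ¹)`), `mem_belt_of_map_eq`
  (fibres of `SΦ` are points or lie on the belt);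
* **`exists_retraction`** — if every map `S⁴ → S(ℂℙ¹)` is null-homotopic (e.g. if `π₄(S³) = 0`),
  then there is a retraction `r : S(ℂℙ²) → S(ℂℙ¹)`.

Everything is proved; no named facts.

## References

* A. Hatcher, *Algebraic Topology*, CUP (2002), Example 0.6, Ch. 0 p. 8, §4.1 p. 346,
  Example 4.45. [HatcherAT2002]
* P. Griffiths, J. Harris, *Principles of Algebraic Geometry* (1978), Ch. 0 §2.
  [GriffithsHarrisPrinciples1978]
-/

noncomputable section

open Set Function Metric Topology unitInterval Complex ComplexConjugate
open scoped Topology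
open Literature.AlgebraicTopology.Homotopy Literature.AlgebraicTopology.Homotopy.HopfFibration

namespace Literature.Topology.FourManifolds

namespace ProjectivePlaneSuspension

open ComplexProjectiveSpace

/-- Local notation: `𝔼 n` is `EuclideanSpace ℝ (Fin n)`. -/
local notation "𝔼 " n:arg => EuclideanSpace ℝ (Fin n)

/-- Local notation: `𝕊 n` is the unit sphere of `EuclideanSpace ℝ (Fin (n + 1))`. -/
local notation "𝕊 " n:arg => (Metric.sphere (0 : EuclideanSpace ℝ (Fin (n + 1))) 1)

/-- Local notation: `𝔻` is the closed unit ball of `ℝ⁴ = ℂ²`. -/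
local notation "𝔻" => (Metric.closedBall (0 : EuclideanSpace ℝ (Fin 4)) 1)


/-! ### The characteristic map of the 4-cell of `ℂℙ²` -/

/-- The third homogeneous coordinate `√(1 - ‖d‖²)` of the characteristic map. [folklore] -/
def rad (d : 𝔼 4) : ℝ := Real.sqrt (1 - ‖d‖ ^ 2)

/-- `rad` is continuous. [folklore] -/
theorem continuous_rad : Continuous rad := Real.continuous_sqrt.comp (continuous_const.sub (continuous_norm.pow 2))

/-- `rad ≥ 0`. [folklore] -/
theorem rad_nonneg (d : 𝔼 4) : 0 ≤ rad d := Real.sqrt_nonneg _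

/-- `rad d ² = 1 - ‖d‖²` on the closed ball. [folklore] -/
theorem rad_sq {d : 𝔼 4} (hd : ‖d‖ ≤ 1) : rad d ^ 2 = 1 - ‖d‖ ^ 2 :=
  Real.sq_sqrt (by nlinarith [norm_nonneg d])

/-- `rad d = 0` exactly on the boundary sphere. [folklore] -/
theorem rad_eq_zero_iff {d : 𝔼 4} (hd : ‖d‖ ≤ 1) : rad d = 0 ↔ ‖d‖ = 1 := by
  unfold rad
  rw [Real.sqrt_eq_zero (by nlinarith [norm_nonneg d])]
  constructor
  · intro h; nlinarith [norm_nonneg d]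
  · intro h; rw [h]; ring

/-- `rad > 0` on the open ball. [folklore] -/
theorem rad_pos {d : 𝔼 4} (hd : ‖d‖ < 1) : 0 < rad d :=
  Real.sqrt_pos.2 (by nlinarith [norm_nonneg d])

/-- The homogeneous vector `(z, w, √(1 - |z|² - |w|²))` of a point `(z, w)` of the closed ball of `ℂ² = ℝ⁴`. [cite: HatcherAT2002, Example 0.6] -/
def charVec (d : 𝔼 4) : Fin 3 → ℂ := ![zC d, wC d, (rad d : ℂ)]

/-- Coordinate `0` of `charVec`. [folklore] -/
@[simp] theorem charVec_zero (d : 𝔼 4) : charVec d 0 = zC d := rfl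
/-- Coordinate `1` of `charVec`. [folklore] -/
@[simp] theorem charVec_one (d : 𝔼 4) : charVec d 1 = wC d := rfl
/-- Coordinate `2` of `charVec`. [folklore] -/
@[simp] theorem charVec_two (d : 𝔼 4) : charVec d 2 = (rad d : ℂ) := rfl

/-- `charVec d ≠ 0`. [folklore] -/
theorem charVec_ne_zero (d : 𝔼 4) : charVec d ≠ 0 := by
  intro h
  have hz : zC d = 0 := by simpa using congrFun h 0
  have hw : wC d = 0 := by simpa using congrFun h 1
  have hr : (rad d : ℂ) = 0 := by simpa using congrFun h 2
  have hn : ‖d‖ ^ 2 = 0 := by rw [norm_sq_eq, hz, hw]; simp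
  have : rad d = 1 := by unfold rad; rw [hn]; simp
  rw [this] at hr
  norm_num at hr

/-- `charVec` is continuous. [folklore] -/
theorem continuous_charVec : Continuous charVec := by
  unfold charVec
  refine continuous_pi fun i => ?_
  fin_cases i
  · exact continuous_zC
  · exact continuous_wC
  · exact continuous_ofReal.comp continuous_rad

/-- **The characteristic map `Φ : D⁴ → ℂℙ²` of the `4`-cell**, `(z, w) ↦ [z : w : √(1 - |z|² - |w|²)]` (Hatcher 2002, Example 0.6: `ℂPⁿ = ℂPⁿ⁻¹ ∪ e²ⁿ` with this characteristic map). [cite: HatcherAT2002, Example 0.6] -/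
def charMap : C(↥𝔻, ComplexProjectiveSpace 2) :=
  ⟨fun d => mk ⟨charVec d, charVec_ne_zero d⟩,
    continuous_mk.comp ((continuous_charVec.comp continuous_subtype_val).subtype_mk _)⟩

/-- `Φ` on points. [folklore] -/
theorem charMap_apply (d : ↥𝔻) : charMap d = mk ⟨charVec d, charVec_ne_zero d⟩ := rfl

/-! ### Injectivity off the boundary -/

/-- Points of the closed ball have norm `≤ 1`. [folklore] -/
theorem norm_le_one (d : ↥𝔻) : ‖(d : 𝔼 4)‖ ≤ 1 := mem_closedBall_zero_iff.1 d.2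

/-- **`Φ` is one-to-one off the boundary**: `Φ d = Φ d'` with `‖d‖ < 1` forces `d = d'` (the scalar relating the homogeneous vectors is real positive of modulus `1`). [cite: HatcherAT2002, Example 0.6] -/
theorem eq_of_charMap_eq {d d' : ↥𝔻} (h : charMap d = charMap d') (hd : ‖(d : 𝔼 4)‖ < 1) : d = d' := by
  rw [charMap_apply, charMap_apply, mk_eq_mk_iff] at h
  obtain ⟨a, ha⟩ := h
  have h0 : a * zC d' = zC d := by simpa using congrFun ha 0
  have h1 : a * wC d' = wC d := by simpa using congrFun ha 1
  have h2 : a * (rad d' : ℂ) = rad d := by simpa using congrFun ha 2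
  have hr : 0 < rad d := rad_pos hd
  have hr'0 : rad d' ≠ 0 := by
    intro h; rw [h] at h2; simp at h2
    exact hr.ne' (by exact_mod_cast h2.symm)
  have hr' : 0 < rad d' := lt_of_le_of_ne (rad_nonneg _) (Ne.symm hr'0)
  -- `a = ρ` real positive
  set ρ : ℝ := rad d / rad d' with hρ
  have hρpos : 0 < ρ := div_pos hr hr'
  have haρ : a = (ρ : ℂ) := by
    have : (rad d' : ℂ) ≠ 0 := by exact_mod_cast hr'0
    rw [hρ]; push_cast
    field_simp
    rw [mul_comm] at h2 ⊢
    exact h2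
  -- norms: `‖d‖² = ρ² ‖d'‖²` and `rad d ² = ρ² rad d' ²`
  have hn : ‖(d : 𝔼 4)‖ ^ 2 = ρ ^ 2 * ‖(d' : 𝔼 4)‖ ^ 2 := by
    rw [norm_sq_eq, norm_sq_eq, ← h0, ← h1, haρ, normSq_mul, normSq_mul, normSq_ofReal]; ring
  have hrr : rad d ^ 2 = ρ ^ 2 * rad d' ^ 2 := by
    have := congrArg normSq h2
    rw [normSq_mul, haρ, normSq_ofReal, normSq_ofReal, normSq_ofReal] at this
    nlinarith [this]
  rw [rad_sq (norm_le_one d), rad_sq (norm_le_one d')] at hrr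
  have hρ1 : ρ ^ 2 = 1 := by nlinarith [hn, hrr]
  have hρ1' : ρ = 1 := by nlinarith [hρpos]
  rw [hρ1'] at haρ
  simp only [ofReal_one] at haρ
  rw [haρ, one_mul] at h0 h1
  apply Subtype.ext
  rw [← ofZW_zC_wC (d : 𝔼 4), ← ofZW_zC_wC (d' : 𝔼 4), h0, h1]

/-- Two distinct points with the same image under `Φ` both lie on the boundary sphere. [cite: HatcherAT2002, Example 0.6] -/
theorem norm_eq_one_of_charMap_eq {d d' : ↥𝔻} (h : charMap d = charMap d') (hne : d ≠ d') :
    ‖(d : 𝔼 4)‖ = 1 ∧ ‖(d' : 𝔼 4)‖ = 1 := by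
  constructor
  · by_contra hd
    exact hne (eq_of_charMap_eq h (lt_of_le_of_ne (norm_le_one d) hd))
  · by_contra hd
    exact hne (eq_of_charMap_eq h.symm (lt_of_le_of_ne (norm_le_one d') hd)).symm

/-! ### The boundary: `Φ(z, w) = [z : w : 0]` factors through `ℂℙ¹` -/

/-- The homogeneous vector `(z, w)` of a point of `S³ ⊂ ℂ²`. [folklore] -/
def sphVec (x : 𝕊 3) : {v : Fin 2 → ℂ // v ≠ 0} :=
  ⟨![zC x, wC x], by
    intro h
    have hz : zC x = 0 := by simpa using congrFun h 0
    have hw : wC x = 0 := by simpa using congrFun h 1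
    have := normSq_add_normSq x
    rw [hz, hw] at this
    simp at this⟩

/-- `sphVec` is continuous. [folklore] -/
theorem continuous_sphVec : Continuous sphVec := by
  refine Continuous.subtype_mk (continuous_pi fun i => ?_) _
  fin_cases i
  · exact continuous_zC.comp continuous_subtype_val
  · exact continuous_wC.comp continuous_subtype_val

/-- **The tautological quotient `S³ → ℂℙ¹`**, `(z, w) ↦ [z : w]` (the attaching map of the `4`-cell of `ℂℙ²`, i.e. the Hopf map up to `ℂℙ¹ ≅ S²`). [cite: HatcherAT2002, Example 0.6, Example 4.45] -/
def hopfC : C(𝕊 3, ComplexProjectiveSpace 1) := ⟨fun x => mk (sphVec x), continuous_mk.comp continuous_sphVec⟩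

/-- `hopfC` on points. [folklore] -/
theorem hopfC_apply (x : 𝕊 3) : hopfC x = mk (sphVec x) := rfl

/-- `S³ → ℂℙ¹` is onto (normalise a homogeneous vector). [folklore] -/
theorem hopfC_surjective : Surjective hopfC := by
  intro p
  induction p using ComplexProjectiveSpace.ind with
  | h v =>
    -- normalise `v` to the unit sphere
    set r : ℝ := Real.sqrt (normSq (v.1 0) + normSq (v.1 1)) with hr
    have hpos : 0 < normSq (v.1 0) + normSq (v.1 1) := by
      rcases v with ⟨v, hv⟩
      by_contra h
      have h' : normSq (v 0) + normSq (v 1) = 0 := le_antisymm (not_lt.1 h) (add_nonneg (normSq_nonneg _) (normSq_nonneg _))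
      have h0 : v 0 = 0 := normSq_eq_zero.1 (by nlinarith [normSq_nonneg (v 0), normSq_nonneg (v 1)])
      have h1 : v 1 = 0 := normSq_eq_zero.1 (by nlinarith [normSq_nonneg (v 0), normSq_nonneg (v 1)])
      exact hv (funext fun i => by fin_cases i <;> simp [h0, h1])
    have hrpos : 0 < r := Real.sqrt_pos.2 hpos
    have hr2 : r ^ 2 = normSq (v.1 0) + normSq (v.1 1) := Real.sq_sqrt hpos.le
    let x : 𝕊 3 := ⟨ofZW (v.1 0 / r) (v.1 1 / r), mem_sphere_ofZW (by
      rw [normSq_div, normSq_div, normSq_ofReal]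
      have : (r : ℝ) * r ≠ 0 := by positivity
      field_simp
      nlinarith [hr2])⟩
    refine ⟨x, ?_⟩
    rw [hopfC_apply, mk_eq_mk_iff]
    refine ⟨(r : ℂ)⁻¹, funext fun i => ?_⟩
    have hrne : (r : ℂ) ≠ 0 := by exact_mod_cast hrpos.ne'
    fin_cases i
    · show (r : ℂ)⁻¹ * v.1 0 = zC (ofZW (v.1 0 / r) (v.1 1 / r))
      rw [zC_ofZW]; field_simp
    · show (r : ℂ)⁻¹ * v.1 1 = wC (ofZW (v.1 0 / r) (v.1 1 / r))
      rw [wC_ofZW]; field_simp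

/-- The line `ℂℙ¹ = {z₂ = 0} ⊂ ℂℙ²` (the tree's `hyperplaneEmb 2`). [folklore] -/
def lineEmb : C(ComplexProjectiveSpace 1, ComplexProjectiveSpace 2) :=
  ⟨hyperplaneEmb (2 : Fin 3), continuous_hyperplaneEmb _⟩

/-- `lineEmb` is one-to-one. [folklore] -/
theorem lineEmb_injective : Injective lineEmb := hyperplaneEmb_injective _

/-- The inclusion `S³ ⊂ D⁴`. [folklore] -/
def sphIncl : C(𝕊 3, ↥𝔻) :=
  ⟨fun x => ⟨x, mem_closedBall_zero_iff.2 (norm_eq_of_mem_sphere x).le⟩,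
    continuous_subtype_val.subtype_mk fun x => mem_closedBall_zero_iff.2 (norm_eq_of_mem_sphere x).le⟩

/-- `sphIncl` on points. [folklore] -/
theorem coe_sphIncl (x : 𝕊 3) : ((sphIncl x : ↥𝔻) : 𝔼 4) = x := rfl

/-- `rad = 0` on the sphere. [folklore] -/
theorem rad_sphere (x : 𝕊 3) : rad (x : 𝔼 4) = 0 := by
  rw [rad_eq_zero_iff (by simp)]; simp

/-- **On the boundary sphere `Φ(z, w) = [z : w : 0]`**: `Φ ∘ (S³ ⊂ D⁴) = (ℂℙ¹ ⊂ ℂℙ²) ∘ (S³ → ℂℙ¹)`. [cite: HatcherAT2002, Example 0.6] -/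
theorem charMap_sphIncl (x : 𝕊 3) : charMap (sphIncl x) = lineEmb (hopfC x) := by
  rw [charMap_apply, hopfC_apply]
  show ComplexProjectiveSpace.mk _ = hyperplaneEmb 2 (ComplexProjectiveSpace.mk (sphVec x))
  rw [hyperplaneEmb_mk]
  congr 1
  apply Subtype.ext
  show charVec (x : 𝔼 4) = Fin.insertNth 2 0 ![zC x, wC x]
  funext i
  fin_cases i
  · rfl
  · rfl
  · simp [rad_sphere]

/-! ### Surjectivity of `Φ` -/

/-- **`Φ` is onto** (rotate the last homogeneous coordinate to be real non-negative and normalise). [cite: HatcherAT2002, Example 0.6] -/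
theorem charMap_surjective : Surjective charMap := by
  intro p
  induction p using ComplexProjectiveSpace.ind with
  | h v =>
    by_cases hc : v.1 2 = 0
    · -- a point of the line at infinity: comes from the boundary sphere
      obtain ⟨x, hx⟩ := hopfC_surjective (mk ⟨![v.1 0, v.1 1], fun h => v.2 (funext fun i => by
        fin_cases i
        · simpa using congrFun h 0
        · simpa using congrFun h 1
        · exact hc)⟩)
      refine ⟨sphIncl x, ?_⟩
      rw [charMap_sphIncl, hx]
      show hyperplaneEmb 2 (ComplexProjectiveSpace.mk _) = ComplexProjectiveSpace.mk v
      rw [hyperplaneEmb_mk]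
      congr 1
      apply Subtype.ext
      funext i
      fin_cases i
      · rfl
      · rfl
      · simp [hc]
    · -- rotate the last coordinate to be real positive and normalise
      set c : ℂ := v.1 2 with hcdef
      set u : ℂ := (‖c‖ : ℂ) / c with hu
      have hcn : (‖c‖ : ℝ) ≠ 0 := norm_ne_zero_iff.2 hc
      have huc : u * c = ‖c‖ := by rw [hu]; field_simp
      have hun : normSq u = 1 := by
        rw [hu, normSq_div, normSq_ofReal, normSq_eq_norm_sq]; field_simp
      set N : ℝ := Real.sqrt (normSq (v.1 0) + normSq (v.1 1) + ‖c‖ ^ 2) with hN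
      have hsum : 0 < normSq (v.1 0) + normSq (v.1 1) + ‖c‖ ^ 2 :=
        add_pos_of_nonneg_of_pos (add_nonneg (normSq_nonneg _) (normSq_nonneg _)) (pow_pos (norm_pos_iff.2 hc) 2)
      have hNpos : 0 < N := Real.sqrt_pos.2 hsum
      have hN2 : N ^ 2 = normSq (v.1 0) + normSq (v.1 1) + ‖c‖ ^ 2 := Real.sq_sqrt hsum.le
      -- the point of the ball
      let z : ℂ := u * v.1 0 / N
      let w : ℂ := u * v.1 1 / N
      have hzw : normSq z + normSq w = (normSq (v.1 0) + normSq (v.1 1)) / N ^ 2 := by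
        show normSq (u * v.1 0 / N) + normSq (u * v.1 1 / N) = _
        rw [normSq_div, normSq_div, normSq_mul, normSq_mul, hun, normSq_ofReal]
        field_simp
      have hle : normSq z + normSq w < 1 := by
        rw [hzw, div_lt_one (by positivity), hN2]
        have : 0 < ‖c‖ ^ 2 := by positivity
        linarith
      let d : ↥𝔻 := ⟨ofZW z w, by
        rw [mem_closedBall_zero_iff]
        have h := norm_ofZW_sq z w
        nlinarith [norm_nonneg (ofZW z w)]⟩
      have hdn : ‖(d : 𝔼 4)‖ ^ 2 = normSq z + normSq w := norm_ofZW_sq z w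
      have hrad : rad (d : 𝔼 4) = ‖c‖ / N := by
        have h1 : rad (d : 𝔼 4) ^ 2 = (‖c‖ / N) ^ 2 := by
          rw [rad_sq (norm_le_one d), hdn, hzw, div_pow]
          field_simp
          nlinarith [hN2]
        have h2 : 0 ≤ ‖c‖ / N := by positivity
        nlinarith [rad_nonneg (d : 𝔼 4), sq_nonneg (rad (d : 𝔼 4) - ‖c‖ / N), sq_nonneg (rad (d : 𝔼 4) + ‖c‖ / N)]
      refine ⟨d, ?_⟩
      rw [charMap_apply, mk_eq_mk_iff]
      refine ⟨u / N, funext fun i => ?_⟩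
      have hNne : (N : ℂ) ≠ 0 := by exact_mod_cast hNpos.ne'
      fin_cases i
      · show u / N * v.1 0 = zC (ofZW z w)
        rw [zC_ofZW]; show u / N * v.1 0 = u * v.1 0 / N; field_simp
      · show u / N * v.1 1 = wC (ofZW z w)
        rw [wC_ofZW]; show u / N * v.1 1 = u * v.1 1 / N; field_simp
      · show u / N * c = (rad (ofZW z w) : ℂ)
        have : rad (ofZW z w) = ‖c‖ / N := hrad
        rw [this]; push_cast
        field_simp
        rw [mul_comm] at huc
        first | exact huc | (rw [mul_comm]; exact huc)

/-! ### Suspending: `q = SΦ : S(D⁴) → S(ℂℙ²)`, the belt `S = S(S³)` and the subcomplex `A = S(ℂℙ¹)` -/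

/-- `sphIncl` is one-to-one. [folklore] -/
theorem sphIncl_injective : Injective sphIncl := fun _ _ h =>
  Subtype.ext (congrArg (fun d : ↥𝔻 => (d : 𝔼 4)) h)

/-- The belt `S(S³) ⊂ S(D⁴)` (suspension of the boundary sphere). [folklore] -/
abbrev belt : Set (Susp ↥𝔻) := range (Susp.map sphIncl)

/-- The subcomplex `S(ℂℙ¹) ⊂ S(ℂℙ²)`. [folklore] -/
abbrev subLine : Set (Susp (ComplexProjectiveSpace 2)) := range (Susp.map lineEmb)

/-- `SΦ ∘ S(S³ ⊂ D⁴) = S(ℂℙ¹ ⊂ ℂℙ²) ∘ S(S³ → ℂℙ¹)`. [folklore] -/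
theorem map_charMap_comp_map_sphIncl :
    (Susp.map charMap).comp (Susp.map sphIncl) = (Susp.map lineEmb).comp (Susp.map hopfC) := by
  rw [← Susp.map_comp, ← Susp.map_comp]
  congr 1
  exact ContinuousMap.ext charMap_sphIncl

/-- Pointwise form of `map_charMap_comp_map_sphIncl`. [folklore] -/
theorem map_charMap_map_sphIncl (w : Susp (𝕊 3)) :
    Susp.map charMap (Susp.map sphIncl w) = Susp.map lineEmb (Susp.map hopfC w) :=
  congrFun (congrArg DFunLike.coe map_charMap_comp_map_sphIncl) w

/-- `SΦ` maps the belt onto `S(ℂℙ¹)`. [folklore] -/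
theorem image_belt : Susp.map charMap '' belt = subLine := by
  apply Set.Subset.antisymm
  · rintro _ ⟨_, ⟨w, rfl⟩, rfl⟩
    exact ⟨Susp.map hopfC w, (map_charMap_map_sphIncl w).symm⟩
  · rintro _ ⟨u, rfl⟩
    obtain ⟨w, rfl⟩ := Susp.map_surjective hopfC_surjective u
    exact ⟨Susp.map sphIncl w, ⟨w, rfl⟩, map_charMap_map_sphIncl w⟩

/-- A point `[d, t]` with `‖d‖ = 1` lies on the belt. [folklore] -/
theorem mk_mem_belt {d : ↥𝔻} (hd : ‖(d : 𝔼 4)‖ = 1) (t : I) : Susp.mk (d, t) ∈ belt := by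
  refine ⟨Susp.mk (⟨(d : 𝔼 4), mem_sphere_zero_iff_norm.2 hd⟩, t), ?_⟩
  rw [Susp.map_mk]
  rfl

/-- **The fibres of `SΦ` are single points or lie on the belt.** [folklore] -/
theorem mem_belt_of_map_eq {z z' : Susp ↥𝔻} (h : Susp.map charMap z = Susp.map charMap z') (hne : z ≠ z') :
    z ∈ belt ∧ z' ∈ belt := by
  induction z using Susp.ind with
  | h x =>
    induction z' using Susp.ind with
    | h x' =>
      rw [Susp.map_mk, Susp.map_mk] at h
      have ht : x.2 = x'.2 := by have := Susp.snd_eq_of_mk_eq h; exact this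
      obtain ⟨d, t⟩ := x
      obtain ⟨d', t'⟩ := x'
      simp only at ht
      subst ht
      by_cases h0 : t = 0
      · subst h0; exact absurd (Susp.mk_zero_eq d d') hne
      by_cases h1 : t = 1
      · subst h1; exact absurd (Susp.mk_one_eq d d') hne
      have hΦ : charMap d = charMap d' := by
        have := Susp.eq_of_mk_eq h h0 h1
        simpa using congrArg Prod.fst this
      have hdd : d ≠ d' := fun e => hne (by rw [e])
      obtain ⟨hd, hd'⟩ := norm_eq_one_of_charMap_eq hΦ hdd
      exact ⟨mk_mem_belt hd t, mk_mem_belt hd' t⟩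

/-! ### `belt ≅ S⁴` and `S(ℂℙ¹) ≅ S³` -/

/-- `S(S³) ≅ belt` (suspension of a closed embedding). [folklore] -/
def beltHomeomorph : Susp (𝕊 3) ≃ₜ ↥belt :=
  (Susp.isClosedEmbedding_map sphIncl_injective).isEmbedding.toHomeomorph

/-- `beltHomeomorph` on points. [folklore] -/
theorem coe_beltHomeomorph (w : Susp (𝕊 3)) : (beltHomeomorph w : Susp ↥𝔻) = Susp.map sphIncl w := rfl

/-- **The belt is a `4`-sphere** (`S(S³) ≅ S⁴`). [cite: HatcherAT2002, Ch. 0 p. 8] -/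
def beltSphere : ↥belt ≃ₜ 𝕊 4 := beltHomeomorph.symm.trans (SuspSphere.homeomorph 3)

/-- `ℂℙ¹ ≅ S²` (the tree's diffeomorphism `nonempty_diffeomorph_complexProjectiveSpace_one_sphere_holds` as a homeomorphism). [cite: GriffithsHarrisPrinciples1978, Ch. 0 §2 (ℂℙ¹ is the Riemann sphere)] -/
def lineSphere : ComplexProjectiveSpace 1 ≃ₜ 𝕊 2 :=
  (Classical.choice nonempty_diffeomorph_complexProjectiveSpace_one_sphere_holds).toHomeomorph

/-- **`S(ℂℙ¹) ⊂ S(ℂℙ²)` is a `3`-sphere** (`S(ℂℙ¹) ≅ S(S²) ≅ S³`). [cite: HatcherAT2002, Ch. 0 p. 8] -/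
def subLineSphere : ↥subLine ≃ₜ 𝕊 3 :=
  ((Susp.isClosedEmbedding_map lineEmb_injective).isEmbedding.toHomeomorph).symm.trans
    ((Susp.mapHomeomorph lineSphere).trans (SuspSphere.homeomorph 2))

/-! ### The retraction of `S(ℂℙ²)` onto `S(ℂℙ¹)` when maps `S⁴ → S³` are null-homotopic -/

/-- On the belt the ball map of `SuspensionSphere.lean` is the comparison map `S(S³) → S⁴`. [folklore] -/
theorem ballMap_map_sphIncl (w : Susp (𝕊 3)) :
    SuspSphere.ballMap 3 (Susp.map sphIncl w) = ((SuspSphere.toSphere 3 w : 𝕊 4) : 𝔼 5) := by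
  induction w using Susp.ind with
  | h x => rfl

/-- **If every map `S⁴ → S(ℂℙ¹)` is null-homotopic then `S(ℂℙ²)` retracts onto `S(ℂℙ¹)`** (Hatcher 2002, §4.1 p. 346, (1) ⇒ (2): a null-homotopic map of the boundary sphere of a cell extends over the cell; here the `5`-cell `S(D⁴) → S(ℂℙ²)` of the suspended cell structure `S(ℂℙ²) = S(ℂℙ¹) ∪ e⁵`: extend `SΦ|belt` over `S(D⁴)` through the ball map and descend along the quotient map `SΦ`, whose fibres are points or lie on the belt). [cite: HatcherAT2002, §4.1 (p. 346), Example 0.6] -/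
theorem exists_retraction (hA : ∀ g : C(𝕊 4, ↥subLine), g.Nullhomotopic) :
    ∃ r : C(Susp (ComplexProjectiveSpace 2), ↥subLine), ∀ a : ↥subLine, r a = a := by
  -- `g₀ = q|belt : belt → S(ℂℙ¹)`
  have hmem : ∀ z : ↥belt, Susp.map charMap (z : Susp ↥𝔻) ∈ subLine := fun z => by
    rw [← image_belt]; exact ⟨z, z.2, rfl⟩
  let g₀ : C(↥belt, ↥subLine) :=
    ⟨fun z => ⟨Susp.map charMap (z : Susp ↥𝔻), hmem z⟩,
      ((Susp.map charMap).continuous.comp continuous_subtype_val).subtype_mk _⟩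
  -- extend `g₀ ∘ belt ≅ S⁴` over `ℝ⁵` and pull back along the ball map
  let f : C(𝕊 4, ↥subLine) := g₀.comp (beltSphere.symm : C(𝕊 4, ↥belt))
  obtain ⟨F, hF⟩ := exists_sphere_extends_of_nullhomotopic f (hA f)
  let R : C(Susp ↥𝔻, ↥subLine) := F.comp (SuspSphere.ballMap 3)
  have hR : ∀ z : ↥belt, R (z : Susp ↥𝔻) = g₀ z := by
    rintro ⟨_, w, rfl⟩
    show F (SuspSphere.ballMap 3 (Susp.map sphIncl w)) = g₀ ⟨_, w, rfl⟩
    rw [ballMap_map_sphIncl]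
    have hw : SuspSphere.toSphere 3 w = beltSphere ⟨Susp.map sphIncl w, w, rfl⟩ := by
      show _ = SuspSphere.homeomorph 3 (beltHomeomorph.symm ⟨Susp.map sphIncl w, w, rfl⟩)
      rw [SuspSphere.coe_homeomorph]
      congr 1
      exact (beltHomeomorph.symm_apply_apply w).symm
    rw [hw, hF]
    show g₀ (beltSphere.symm (beltSphere ⟨_, w, rfl⟩)) = _
    rw [Homeomorph.symm_apply_apply]
  -- descend along the quotient map `q`
  have hq : IsQuotientMap (Susp.map charMap) := Susp.isQuotientMap_map charMap_surjective
  have hfac : Function.FactorsThrough R (Susp.map charMap) := by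
    intro z z' h
    by_cases hzz : z = z'
    · rw [hzz]
    · obtain ⟨hz, hz'⟩ := mem_belt_of_map_eq h hzz
      rw [hR ⟨z, hz⟩, hR ⟨z', hz'⟩]
      exact Subtype.ext h
  refine ⟨hq.lift R hfac, ?_⟩
  rintro ⟨a, ha⟩
  obtain ⟨z, hz, rfl⟩ : a ∈ Susp.map charMap '' belt := by rw [image_belt]; exact ha
  have h1 : hq.lift R hfac (Susp.map charMap z) = R z :=
    congrFun (congrArg DFunLike.coe (hq.lift_comp R hfac)) z
  rw [h1, hR ⟨z, hz⟩]
  rfl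


end ProjectivePlaneSuspension

end Literature.Topology.FourManifolds

end
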